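import Literature.Analysis.FluidPDE.FluidComputer.ThresholdLevelTableX
import HarnessLib

/-!
# Kernel run of the level-table checker over the WIDER gate-data box (all seven data within 1/300), chunks 20 … 23 (bp3 gen 13, layer 4: robustness variant X)

HONEST FRAMING: low prior, high value-of-information experiment on Tao's machine paradigm; NOT a
claim that NS blows up.

Four kernel evaluations (`decide +kernel`; no `native_decide`, no extra axioms) of `runSteps`
with the interval gate data `GIx` (all seven data within relative `1/300`, `δ ∈ [0, (1 + 1/300) δ₀]`),
25 steps each, from `Bx20` to `Bx24`.
-/

namespace Literature.Analysis.FluidPDE.FluidComputer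

namespace ThresholdLevelTable

set_option maxHeartbeats 10000000 in
set_option maxRecDepth 200000 in
/-- Chunk 20 of the wider-data-box table run (steps 500 … 524). [folklore] -/
theorem runX20 : runSteps 60 12 3 GIx RbIt Bx20 chunk20 18218920983040980 = some Bx21 := by
  decide +kernel

set_option maxHeartbeats 10000000 in
set_option maxRecDepth 200000 in
/-- Chunk 21 of the wider-data-box table run (steps 525 … 549). [folklore] -/
theorem runX21 : runSteps 60 12 3 GIx RbIt Bx21 chunk21 21683499329800700 = some Bx22 := by
  decide +kernel

set_option maxHeartbeats 10000000 in
set_option maxRecDepth 200000 in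
/-- Chunk 22 of the wider-data-box table run (steps 550 … 574). [folklore] -/
theorem runX22 : runSteps 60 12 3 GIx RbIt Bx22 chunk22 25806914889368432 = some Bx23 := by
  decide +kernel

set_option maxHeartbeats 10000000 in
set_option maxRecDepth 200000 in
/-- Chunk 23 of the wider-data-box table run (steps 575 … 599). [folklore] -/
theorem runX23 : runSteps 60 12 3 GIx RbIt Bx23 chunk23 30714454617193348 = some Bx24 := by
  decide +kernel

end ThresholdLevelTable

end Literature.Analysis.FluidPDE.FluidComputer
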